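import Summits.CriticalPhenomena.SAWScalingLimit.Theses.SAWZoomRigidity
import Literature.Probability.RandomPlanarGeometry.ZoomFlow
import Literature.Probability.RandomPlanarGeometry.ChordalReversibility
import Literature.Probability.RandomPlanarGeometry.ChordalRestrictionMarkov
import HarnessLib.Audit

/-!
# Birth skeleton for crux `ZoomRigidity` (stmt-CriticalPhenomena-6500), route SAWZoomRigidity

Crux, BY NAME: `Summit.CriticalPhenomena.SAWScalingLimit.Theses.SAWZoomRigidity.ZoomRigidity` —
every sequentially compact, zoom-invariant set `Ω` of NICE chordal families (chordal,
restriction–Markov, reversible, covariant under `z ↦ iᵏ z + w` and conjugation, simple and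
boundary-avoiding) consists of DILATION-covariant families.

## The line `birth` = the route's own two-layer plan, typed over the zoom flow `ChordalFamily.zoom`

Write `Z_t P := P.zoom t` (`Literature/…/ZoomFlow.lean`: `(P.zoom t) D = (t⁻¹·)_* P (t·D)`, a flow,
`zoom_spec`/`zoom_unique`; dilation covariance = `P.IsDilationCovariant :↔ ∀ t > 0, P.zoom t = P`,
`isDilationCovariant_iff`). For `P ∈ Ω` the crux's hypothesis (ii) says exactly `Z_t P ∈ Ω` (`t > 0`),
and (iii) makes the forward (`t → ∞`, "ω") and backward (`t → 0⁺`, "α") sequential limit sets of the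
orbit `t ↦ Z_t P` nonempty inside `Ω`. The crux is then the conjunction of three dynamical statements
about the zoom flow on such an `Ω` (route header, TWO-LAYER PLAN: "RS → NW → ZoomRigidity, glue =
topological dynamics on a compact invariant Ω: every nonempty closed Z-invariant subset contains a
minimal set, whose points are zoom-recurrent; α- and ω-limit sets of P ∈ Ω are such subsets"):

* `stub_recurrentLimitPoint` (B, "Birkhoff on a limit set"): if the orbit of `P ∈ Ω` has a limit point
  in `Ω` in the time direction `l ∈ {atTop, 𝓝 0}`, then it has a limit point `P₂ ∈ Ω` in that direction
  which is ZOOM-RECURRENT (`Z_{tₙ} P₂ → P₂` domainwise along some `tₙ → ∞` or `tₙ → 0⁺`). Topological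
  dynamics in the sequential, non-metrisable "domainwise weak" convergence: needs a countable
  determination / diagonal lemma for NICE families (restriction squeeze + translation covariance) before
  Zorn–Birkhoff applies. A consequence of the crux (fixed points are recurrent), so exactly as safe.
* `stub_recurrenceRigidity` (R = the card's (RS), the conjectural core): a zoom-recurrent member of such
  an `Ω` is a fixed point of the zoom flow (dilation covariant) — no log-periodic / recurrent-but-not-fixed
  NICE family (Krylov–Bogolyubov / zoom-stationary ensembles of restriction–Markov families; Hochman-type
  classification is its measure form). A consequence of the crux.
* `stub_noConnectingOrbit` (W = the auditor's NW): a member of `Ω` whose forward orbit accumulates at a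
  FIXED member of `Ω` and whose backward orbit accumulates at a FIXED member of `Ω` is itself fixed — no
  RG trajectory inside NICE joining two scale-invariant NICE families. A consequence of the crux.

`ZoomRigidity_of (hB) (hR) (hW) : …SAWZoomRigidity.ZoomRigidity` is PROVED below (no `sorry` of its
own): (0) the orbit of `P ∈ Ω` stays in `Ω` (hypothesis (ii) + `zoom_unique`); (1)–(2) forward and
backward limit points `P₁, P₂ ∈ Ω` exist by sequential compactness (iii) applied to `Z_{n+1} P` and
`Z_{1/(n+1)} P`; (B) upgrades them to recurrent limit points `Pω, Pα ∈ Ω`; (R) makes `Pω, Pα` fixed;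
(W) makes `P` fixed; `isDilationCovariant_iff` is the crux's conclusion (the proof of `(r:ℂ) ≠ 0` is
irrelevant). The hypotheses of `ZoomRigidity_of` are the stub statements keyed BY NAME
(`__Registered.stub_*`, the skeleton-check convention of `AxiomsOfLimit/Lines/birth.lean`); the final
`example` wires the three sorried stubs into it, so the registered texts are checked against the glue.

Stubs are stated over TREE VOCABULARY ONLY (`ChordalFamily.IsChordal / IsRestrictionMarkov /
IsReversible / zoom / IsDilationCovariant`, `MarkedDomain.map`, `similarity`, `CurveClass.map / simple`,
Bochner integrals of `BoundedContinuousFunction`s), each carrying the crux's context on `Ω` —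
(i) NICE members (`isRestrictionMarkov_iff`, `isReversible_iff` are `Iff.rfl` with the crux's inlined
clauses), (ii) zoom invariance verbatim, (iii) sequential compactness verbatim — so that each stub is
literally implied by the crux and lands as a `Theorems/…` file `--supports stmt-CriticalPhenomena-6500`
without importing this workfile.

Sorries: exactly 3 = the three `stub_*`; zero elsewhere. Disproof used: none (no `Disproof.lean` /
`Negative/*` on this crux at registration, `ledger crux ls`). Negatives honoured: no refuted statement of
the summit concerns zoom dynamics (`ledger negatives --problem CriticalPhenomena`); the all-δ tightness
stmt-0772 is not touched (continuum only). BC3 probes (planner folder `bc/ZoomRigidity_probe_*.lean`):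
for each stub, `stub → ZoomRigidity` and `stub → SAWScalingLimit` by
`first | exact? | simpa | (unfold; simpa) | aesop` FAIL; dedup `example : stub := by exact?` FAILS.
-/

noncomputable section

open MeasureTheory Filter Topology Set
open scoped Topology MeasureTheory ENNReal NNReal
open Literature.Probability.RandomPlanarGeometry

namespace Summit.CriticalPhenomena.SAWScalingLimit.Cruxes.ZoomRigidity.Birth

/-! ## The registered stubs (the ONLY `sorry`s of this file)

Common context of all three (the crux's hypotheses on `Ω`, tree vocabulary):
(i) every member of `Ω` is NICE; (ii) `Ω` is zoom-invariant; (iii) `Ω` is sequentially compact for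
domainwise weak convergence. A "limit point of the orbit of `P` in direction `l`" (`l = atTop`: forward /
ω; `l = 𝓝 0`: backward / α) is a `P'` with `∫ f d(P.zoom (rₙ) D) → ∫ f d(P' D)` for all `D`, all bounded
continuous `f`, along some positive `rₙ → l`; "zoom-recurrent" = limit point of its own orbit in some
direction. -/

/-- **stub (B) — a limit set of a zoom orbit inside `Ω` contains a zoom-recurrent family**
(Birkhoff's recurrence theorem for the zoom flow restricted to the (nonempty, by hypothesis) `l`-limit
set of the orbit of `P` inside the sequentially compact invariant set `Ω`). Why plausibly true: it is
pure topological dynamics once the domainwise-weak convergence on NICE families is shown to be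
determined by countably many tests (translation covariance + restriction squeeze
`d_TV(P_{D⁻}, P_D) ≤ 2 P_D(γ ⊄ cl D⁻)` + boundary avoidance give continuity in `D`), after which
`Ω` is a compact metrisable flow and Zorn/Birkhoff apply; independently, it is implied by the crux
(every member of `Ω` fixed ⇒ recurrent). Size: L. Sources: Furstenberg2008 (CP-chains),
Hochman2010FractalDistributions (arXiv:1008.3731, Thm 1.7), Birkhoff recurrence (e.g. Furstenberg,
Recurrence in ergodic theory and combinatorial number theory, Thm 1.1/2.1). -/
theorem stub_recurrentLimitPoint : ∀ Ω : Set ChordalFamily, (∀ Q ∈ Ω, Q.IsChordal ∧ Q.IsRestrictionMarkov ∧ Q.IsReversible ∧ (∀ (D : DobrushinDomain) (c : ℂ) (hc : c ≠ 0) (w : ℂ), (∃ k : ℕ, c = Complex.I ^ k) → Q (D.map (similarity c hc w)) = (Q D).map (CurveClass.map (similarity c hc w : C(ℂ, ℂ)))) ∧ (∀ D : DobrushinDomain, Q (D.map Complex.conjLIE.toHomeomorph) = (Q D).map (CurveClass.map (Complex.conjLIE.toHomeomorph : C(ℂ, ℂ)))) ∧ (∀ D : DobrushinDomain, ∀ᵐ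 γ ∂(Q D), γ ∈ CurveClass.simple ∧ γ.range ∩ frontier D.carrier ⊆ {D.pt 0, D.pt 1})) → (∀ Q ∈ Ω, ∀ (r : ℝ) (hr : (r : ℂ) ≠ 0), 0 < r → ∃ Q' ∈ Ω, ∀ D : DobrushinDomain, Q (D.map (similarity (r : ℂ) hr 0)) = (Q' D).map (CurveClass.map (similarity (r : ℂ) hr 0 : C(ℂ, ℂ)))) → (∀ u : ℕ → ChordalFamily, (∀ n, u n ∈ Ω) → ∃ Q ∈ Ω, ∃ φ : ℕ → ℕ, StrictMono φ ∧ ∀ (D : DobrushinDomain) (f : BoundedContinuousFunction (CurveClass ℂ) ℝ), Tendsto (fun n => ∫ γ, f γ ∂(u (φ n) D)) atTop (𝓝 (∫ γ, f γ ∂(Q D)))) → ∀ l : Filter ℝ, (l = atTop ∨ l = 𝓝 0) → ∀ P ∈ Ω, ∀ P₁ ∈ Ω, (∃ r : ℕ → ℝ, (∀ n, 0 < r n) ∧ Tendsto r atTop l ∧ ∀ (D : DobrushinDomain) (f : BoundedContinuousFunction (CurveClass ℂ) ℝ), Tendsto (fun n => ∫ γ, f γ ∂(P.zoom (r n) D))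 atTop (𝓝 (∫ γ, f γ ∂(P₁ D)))) → ∃ P₂ ∈ Ω, (∃ r : ℕ → ℝ, (∀ n, 0 < r n) ∧ Tendsto r atTop l ∧ ∀ (D : DobrushinDomain) (f : BoundedContinuousFunction (CurveClass ℂ) ℝ), Tendsto (fun n => ∫ γ, f γ ∂(P.zoom (r n) D)) atTop (𝓝 (∫ γ, f γ ∂(P₂ D)))) ∧ ∃ l' : Filter ℝ, (l' = atTop ∨ l' = 𝓝 0) ∧ ∃ t : ℕ → ℝ, (∀ n, 0 < t n) ∧ Tendsto t atTop l' ∧ ∀ (D : DobrushinDomain) (f : BoundedContinuousFunction (CurveClass ℂ) ℝ), Tendsto (fun n => ∫ γ, f γ ∂(P₂.zoom (t n) D)) atTop (𝓝 (∫ γ, f γ ∂(P₂ D))) := by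
  sorry

/-- **stub (R) — recurrence rigidity (the card's (RS); hardest, the conjectural core)**: a member of
`Ω` that is a limit point of ITS OWN zoom orbit (forward, `tₙ → ∞`, or backward, `tₙ → 0⁺`) is a fixed
point of the zoom flow, i.e. dilation covariant. Excludes log-periodic (`P.zoom 2 = P ≠ P.zoom √2`) and
any recurrent-but-not-fixed NICE family; intended attack: the restriction-coupled Markov kernel couples
scale `e^{-s}` at the tip to unit scale (Krylov–Bogolyubov averages of `s ↦ Z_{e^s} P` along the
recurrence times give a zoom-STATIONARY ensemble of NICE families; classify those, Hochman-style, and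
read off that a recurrent point of a rigid stationary ensemble is fixed). Implied by the crux. Size: XL
(open). Sources: Hochman2010FractalDistributions (arXiv:1008.3731 Def 1.2, Thm 1.3),
KaenmakiSahlstenShmerkin2015 (arXiv:1312.2567: invariance alone is not rigid — all rigidity must come
from restriction/Markov), LawlerSchrammWerner2003Restriction (arXiv:math/0209343 §3), arXiv:1102.3789
(RG limit cycles: the physics precedent this stub denies inside NICE). -/
theorem stub_recurrenceRigidity : ∀ Ω : Set ChordalFamily, (∀ Q ∈ Ω, Q.IsChordal ∧ Q.IsRestrictionMarkov ∧ Q.IsReversible ∧ (∀ (D : DobrushinDomain) (c : ℂ) (hc : c ≠ 0) (w : ℂ), (∃ k : ℕ, c = Complex.I ^ k) → Q (D.map (similarity c hc w)) = (Q D).map (CurveClass.map (similarity c hc w : C(ℂ, ℂ)))) ∧ (∀ D : DobrushinDomain, Q (D.map Complex.conjLIE.toHomeomorph) = (Q D).map (CurveClass.map (Complex.conjLIE.toHomeomorph : C(ℂ, ℂ)))) ∧ (∀ D : DobrushinDomain, ∀ᵐ γ ∂(Q D), γ ∈ CurveClass.simple ∧ γ.range ∩ frontier D.carrier ⊆ {D.pt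 0, D.pt 1})) → (∀ Q ∈ Ω, ∀ (r : ℝ) (hr : (r : ℂ) ≠ 0), 0 < r → ∃ Q' ∈ Ω, ∀ D : DobrushinDomain, Q (D.map (similarity (r : ℂ) hr 0)) = (Q' D).map (CurveClass.map (similarity (r : ℂ) hr 0 : C(ℂ, ℂ)))) → (∀ u : ℕ → ChordalFamily, (∀ n, u n ∈ Ω) → ∃ Q ∈ Ω, ∃ φ : ℕ → ℕ, StrictMono φ ∧ ∀ (D : DobrushinDomain) (f : BoundedContinuousFunction (CurveClass ℂ) ℝ), Tendsto (fun n => ∫ γ, f γ ∂(u (φ n) D)) atTop (𝓝 (∫ γ, f γ ∂(Q D)))) → ∀ P ∈ Ω, (∃ l : Filter ℝ, (l = atTop ∨ l = 𝓝 0) ∧ ∃ t : ℕ → ℝ, (∀ n, 0 < t n) ∧ Tendsto t atTop l ∧ ∀ (D : DobrushinDomain) (f : BoundedContinuousFunction (CurveClass ℂ) ℝ), Tendsto (fun n => ∫ γ, f γ ∂(P.zoom (t n) D)) atTop (𝓝 (∫ γ, f γ ∂(P D)))) → P.IsDilationCovariant := by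
  sorry

/-- **stub (W) — no connecting orbit (the auditor's NW)**: a member of `Ω` whose FORWARD orbit has a
dilation-covariant limit point in `Ω` and whose BACKWARD orbit has a dilation-covariant limit point in
`Ω` is itself dilation covariant — no renormalisation trajectory inside NICE joining a scale-invariant
NICE family at small scales to one at large scales (e.g. the natural-length tilt `Y_c` of SLE_{8/3},
`Z_r Y_c = Y_{c r^{4/3}}`, arXiv:1211.4146, flows out of SLE_{8/3} but its strong-tilt end must LEAVE
NICE). Intended attack: a scale-monotone quantity built from the restriction exponent / one-arm
avoidance probabilities, equal at both ends only if constant. Implied by the crux. Size: L–XL (open).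
Sources: LawlerSchrammWerner2003Restriction (arXiv:math/0209343, Thm 6.1: one-parameter restriction
families, exponent 5/8 at the simple end), arXiv:1211.4146, Beffara2008Universal (arXiv:0708.3908 §2). -/
theorem stub_noConnectingOrbit : ∀ Ω : Set ChordalFamily, (∀ Q ∈ Ω, Q.IsChordal ∧ Q.IsRestrictionMarkov ∧ Q.IsReversible ∧ (∀ (D : DobrushinDomain) (c : ℂ) (hc : c ≠ 0) (w : ℂ), (∃ k : ℕ, c = Complex.I ^ k) → Q (D.map (similarity c hc w)) = (Q D).map (CurveClass.map (similarity c hc w : C(ℂ, ℂ)))) ∧ (∀ D : DobrushinDomain, Q (D.map Complex.conjLIE.toHomeomorph) = (Q D).map (CurveClass.map (Complex.conjLIE.toHomeomorph : C(ℂ, ℂ)))) ∧ (∀ D : DobrushinDomain, ∀ᵐ γ ∂(Q D), γ ∈ CurveClass.simple ∧ γ.range ∩ frontier D.carrier ⊆ {D.pt 0, D.pt 1})) → (∀ Q ∈ Ω, ∀ (r : ℝ) (hr : (r : ℂ) ≠ 0), 0 < r → ∃ Q' ∈ Ω, ∀ D : DobrushinDomain, Q (D.map (similarity (r : ℂ)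 hr 0)) = (Q' D).map (CurveClass.map (similarity (r : ℂ) hr 0 : C(ℂ, ℂ)))) → (∀ u : ℕ → ChordalFamily, (∀ n, u n ∈ Ω) → ∃ Q ∈ Ω, ∃ φ : ℕ → ℕ, StrictMono φ ∧ ∀ (D : DobrushinDomain) (f : BoundedContinuousFunction (CurveClass ℂ) ℝ), Tendsto (fun n => ∫ γ, f γ ∂(u (φ n) D)) atTop (𝓝 (∫ γ, f γ ∂(Q D)))) → ∀ P ∈ Ω, (∃ Pω ∈ Ω, Pω.IsDilationCovariant ∧ ∃ r : ℕ → ℝ, (∀ n, 0 < r n) ∧ Tendsto r atTop atTop ∧ ∀ (D : DobrushinDomain) (f : BoundedContinuousFunction (CurveClass ℂ) ℝ), Tendsto (fun n => ∫ γ, f γ ∂(P.zoom (r n) D)) atTop (𝓝 (∫ γ, f γ ∂(Pω D)))) → (∃ Pα ∈ Ω, Pα.IsDilationCovariant ∧ ∃ s : ℕ → ℝ, (∀ n, 0 < s n) ∧ Tendsto s atTop (𝓝 0) ∧ ∀ (D : DobrushinDomain) (f : BoundedContinuousFunction (CurveClass ℂ) ℝ), Tendsto (fun n => ∫ γ, f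 γ ∂(P.zoom (s n) D)) atTop (𝓝 (∫ γ, f γ ∂(Pα D)))) → P.IsDilationCovariant := by
  sorry

/-! ## Name-keyed aliases of the stub statements (skeleton-check convention)

The native skeleton audit (`#h21_check_skeleton`) admits a hypothesis of the skeleton theorem only if its
head constant is a registered obligation or is NAMED like a declared stub; `__Registered.stub_X` is the
statement of `stub_X` under that name (device of `AxiomsOfLimit/Lines/birth.lean`). The wiring `example`
at the end certifies that each alias is definitionally the type of its sorried stub. -/
namespace __Registered

/-- Alias keyed by the stub name: the statement of `stub_recurrentLimitPoint`. -/
abbrev stub_recurrentLimitPoint : Prop := ∀ Ω : Set ChordalFamily, (∀ Q ∈ Ω, Q.IsChordal ∧ Q.IsRestrictionMarkov ∧ Q.IsReversible ∧ (∀ (D : DobrushinDomain) (c : ℂ) (hc : c ≠ 0) (w : ℂ), (∃ k : ℕ, c = Complex.I ^ k) → Q (D.map (similarity c hc w)) = (Q D).map (CurveClass.map (similarity c hc w : C(ℂ, ℂ)))) ∧ (∀ D : DobrushinDomain, Q (D.map Complex.conjLIE.toHomeomorph) = (Q D).map (CurveClass.map (Complex.conjLIE.toHomeomorph : C(ℂ,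 ℂ)))) ∧ (∀ D : DobrushinDomain, ∀ᵐ γ ∂(Q D), γ ∈ CurveClass.simple ∧ γ.range ∩ frontier D.carrier ⊆ {D.pt 0, D.pt 1})) → (∀ Q ∈ Ω, ∀ (r : ℝ) (hr : (r : ℂ) ≠ 0), 0 < r → ∃ Q' ∈ Ω, ∀ D : DobrushinDomain, Q (D.map (similarity (r : ℂ) hr 0)) = (Q' D).map (CurveClass.map (similarity (r : ℂ) hr 0 : C(ℂ, ℂ)))) → (∀ u : ℕ → ChordalFamily, (∀ n, u n ∈ Ω) → ∃ Q ∈ Ω, ∃ φ : ℕ → ℕ, StrictMono φ ∧ ∀ (D : DobrushinDomain) (f : BoundedContinuousFunction (CurveClass ℂ) ℝ), Tendsto (fun n => ∫ γ, f γ ∂(u (φ n) D)) atTop (𝓝 (∫ γ, f γ ∂(Q D)))) → ∀ l : Filter ℝ, (l = atTop ∨ l = 𝓝 0) → ∀ P ∈ Ω, ∀ P₁ ∈ Ω, (∃ r : ℕ → ℝ, (∀ n, 0 < r n) ∧ Tendsto r atTop l ∧ ∀ (D : DobrushinDomain) (f : BoundedContinuousFunction (CurveClass ℂ) ℝ), Tendsto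 (fun n => ∫ γ, f γ ∂(P.zoom (r n) D)) atTop (𝓝 (∫ γ, f γ ∂(P₁ D)))) → ∃ P₂ ∈ Ω, (∃ r : ℕ → ℝ, (∀ n, 0 < r n) ∧ Tendsto r atTop l ∧ ∀ (D : DobrushinDomain) (f : BoundedContinuousFunction (CurveClass ℂ) ℝ), Tendsto (fun n => ∫ γ, f γ ∂(P.zoom (r n) D)) atTop (𝓝 (∫ γ, f γ ∂(P₂ D)))) ∧ ∃ l' : Filter ℝ, (l' = atTop ∨ l' = 𝓝 0) ∧ ∃ t : ℕ → ℝ, (∀ n, 0 < t n) ∧ Tendsto t atTop l' ∧ ∀ (D : DobrushinDomain) (f : BoundedContinuousFunction (CurveClass ℂ) ℝ), Tendsto (fun n => ∫ γ, f γ ∂(P₂.zoom (t n) D)) atTop (𝓝 (∫ γ, f γ ∂(P₂ D)))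

/-- Alias keyed by the stub name: the statement of `stub_recurrenceRigidity`. -/
abbrev stub_recurrenceRigidity : Prop := ∀ Ω : Set ChordalFamily, (∀ Q ∈ Ω, Q.IsChordal ∧ Q.IsRestrictionMarkov ∧ Q.IsReversible ∧ (∀ (D : DobrushinDomain) (c : ℂ) (hc : c ≠ 0) (w : ℂ), (∃ k : ℕ, c = Complex.I ^ k) → Q (D.map (similarity c hc w)) = (Q D).map (CurveClass.map (similarity c hc w : C(ℂ, ℂ)))) ∧ (∀ D : DobrushinDomain, Q (D.map Complex.conjLIE.toHomeomorph) = (Q D).map (CurveClass.map (Complex.conjLIE.toHomeomorph : C(ℂ, ℂ)))) ∧ (∀ D : DobrushinDomain, ∀ᵐ γ ∂(Q D), γ ∈ CurveClass.simple ∧ γ.range ∩ frontier D.carrier ⊆ {D.pt 0, D.pt 1})) → (∀ Q ∈ Ω, ∀ (r : ℝ) (hr : (r : ℂ) ≠ 0), 0 < r → ∃ Q' ∈ Ω, ∀ D : DobrushinDomain, Q (D.map (similarity (r : ℂ) hr 0)) = (Q' D).map (CurveClass.map (similarity (r : ℂ) hr 0 : C(ℂ, ℂ)))) → (∀ u : ℕ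 → ChordalFamily, (∀ n, u n ∈ Ω) → ∃ Q ∈ Ω, ∃ φ : ℕ → ℕ, StrictMono φ ∧ ∀ (D : DobrushinDomain) (f : BoundedContinuousFunction (CurveClass ℂ) ℝ), Tendsto (fun n => ∫ γ, f γ ∂(u (φ n) D)) atTop (𝓝 (∫ γ, f γ ∂(Q D)))) → ∀ P ∈ Ω, (∃ l : Filter ℝ, (l = atTop ∨ l = 𝓝 0) ∧ ∃ t : ℕ → ℝ, (∀ n, 0 < t n) ∧ Tendsto t atTop l ∧ ∀ (D : DobrushinDomain) (f : BoundedContinuousFunction (CurveClass ℂ) ℝ), Tendsto (fun n => ∫ γ, f γ ∂(P.zoom (t n) D)) atTop (𝓝 (∫ γ, f γ ∂(P D)))) → P.IsDilationCovariant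

/-- Alias keyed by the stub name: the statement of `stub_noConnectingOrbit`. -/
abbrev stub_noConnectingOrbit : Prop := ∀ Ω : Set ChordalFamily, (∀ Q ∈ Ω, Q.IsChordal ∧ Q.IsRestrictionMarkov ∧ Q.IsReversible ∧ (∀ (D : DobrushinDomain) (c : ℂ) (hc : c ≠ 0) (w : ℂ), (∃ k : ℕ, c = Complex.I ^ k) → Q (D.map (similarity c hc w)) = (Q D).map (CurveClass.map (similarity c hc w : C(ℂ, ℂ)))) ∧ (∀ D : DobrushinDomain, Q (D.map Complex.conjLIE.toHomeomorph) = (Q D).map (CurveClass.map (Complex.conjLIE.toHomeomorph : C(ℂ, ℂ)))) ∧ (∀ D : DobrushinDomain, ∀ᵐ γ ∂(Q D), γ ∈ CurveClass.simple ∧ γ.range ∩ frontier D.carrier ⊆ {D.pt 0, D.pt 1})) → (∀ Q ∈ Ω, ∀ (r : ℝ) (hr : (r : ℂ) ≠ 0), 0 < r → ∃ Q' ∈ Ω, ∀ D : DobrushinDomain, Q (D.map (similarity (r : ℂ) hr 0)) = (Q' D).map (CurveClass.map (similarity (r : ℂ) hr 0 : C(ℂ, ℂ)))) → (∀ u : ℕ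 → ChordalFamily, (∀ n, u n ∈ Ω) → ∃ Q ∈ Ω, ∃ φ : ℕ → ℕ, StrictMono φ ∧ ∀ (D : DobrushinDomain) (f : BoundedContinuousFunction (CurveClass ℂ) ℝ), Tendsto (fun n => ∫ γ, f γ ∂(u (φ n) D)) atTop (𝓝 (∫ γ, f γ ∂(Q D)))) → ∀ P ∈ Ω, (∃ Pω ∈ Ω, Pω.IsDilationCovariant ∧ ∃ r : ℕ → ℝ, (∀ n, 0 < r n) ∧ Tendsto r atTop atTop ∧ ∀ (D : DobrushinDomain) (f : BoundedContinuousFunction (CurveClass ℂ) ℝ), Tendsto (fun n => ∫ γ, f γ ∂(P.zoom (r n) D)) atTop (𝓝 (∫ γ, f γ ∂(Pω D)))) → (∃ Pα ∈ Ω, Pα.IsDilationCovariant ∧ ∃ s : ℕ → ℝ, (∀ n, 0 < s n) ∧ Tendsto s atTop (𝓝 0) ∧ ∀ (D : DobrushinDomain) (f : BoundedContinuousFunction (CurveClass ℂ) ℝ), Tendsto (fun n => ∫ γ, f γ ∂(P.zoom (s n) D)) atTop (𝓝 (∫ γ, f γ ∂(Pα D)))) → P.IsDilationCovariant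

end __Registered

/-! ## The skeleton theorem: (B), (R), (W) imply the crux, BY NAME -/

/-- **`ZoomRigidity` from the line `birth`** (kernel-checked, no `sorry` of its own). Hypotheses = the
three stubs under their registered names; conclusion = the route decl, by name. The proof is the α/ω-limit
argument: the zoom orbit of `P ∈ Ω` stays in `Ω` ((ii) + `zoom_unique`), sequential compactness (iii)
extracts a forward limit point along `Z_{n+1} P` and a backward one along `Z_{1/(n+1)} P`, (B) upgrades
each to a zoom-recurrent limit point, (R) makes those fixed, (W) transfers fixedness to `P`, and a fixed
point of the zoom flow satisfies the crux's dilation clause (`isDilationCovariant_iff`). -/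
theorem ZoomRigidity_of (hB : __Registered.stub_recurrentLimitPoint)
    (hR : __Registered.stub_recurrenceRigidity) (hW : __Registered.stub_noConnectingOrbit) :
    Summit.CriticalPhenomena.SAWScalingLimit.Theses.SAWZoomRigidity.ZoomRigidity := by
  intro Ω hN hZ hC P hP D r hr hr0
  -- (i) in tree vocabulary (`IsRestrictionMarkov`, `IsReversible` unfold to the crux's inlined clauses)
  have hN' : ∀ Q ∈ Ω, Q.IsChordal ∧ Q.IsRestrictionMarkov ∧ Q.IsReversible ∧
      (∀ (D : DobrushinDomain) (c : ℂ) (hc : c ≠ 0) (w : ℂ), (∃ k : ℕ, c = Complex.I ^ k) →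
        Q (D.map (similarity c hc w)) = (Q D).map (CurveClass.map (similarity c hc w : C(ℂ, ℂ)))) ∧
      (∀ D : DobrushinDomain, Q (D.map Complex.conjLIE.toHomeomorph) =
        (Q D).map (CurveClass.map (Complex.conjLIE.toHomeomorph : C(ℂ, ℂ)))) ∧
      (∀ D : DobrushinDomain, ∀ᵐ γ ∂(Q D),
        γ ∈ CurveClass.simple ∧ γ.range ∩ frontier D.carrier ⊆ {D.pt 0, D.pt 1}) := by
    intro Q hQ
    obtain ⟨h1, ⟨K, hK, hKr⟩, h3, h4, h5, h6⟩ := hN Q hQ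
    exact ⟨h1, ⟨K, hK, hKr⟩, h3, h4, h5, h6⟩
  -- (0) the zoom orbit of a member of Ω stays in Ω: hypothesis (ii) + `zoom_unique`
  have hmem : ∀ Q ∈ Ω, ∀ t : ℝ, 0 < t → Q.zoom t ∈ Ω := by
    intro Q hQ t ht
    obtain ⟨Q', hQ', hQQ'⟩ := hZ Q hQ t (Complex.ofReal_ne_zero.2 ht.ne') ht
    have h : Q.zoom t = Q' := funext fun D' => Q.zoom_unique ht.ne' (hQQ' D')
    rw [h]
    exact hQ'
  -- (1) a forward (ω-) limit point P₁ ∈ Ω of the orbit, from the sequence `Z_{n+1} P` by (iii)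
  obtain ⟨P₁, hP₁, φ, hφ, hconv₁⟩ :=
    hC (fun n => P.zoom ((n : ℝ) + 1)) fun n => hmem P hP _ (by positivity)
  have hlim₁ : ∃ r : ℕ → ℝ, (∀ n, 0 < r n) ∧ Tendsto r atTop atTop ∧
      ∀ (D : DobrushinDomain) (f : BoundedContinuousFunction (CurveClass ℂ) ℝ),
        Tendsto (fun n => ∫ γ, f γ ∂(P.zoom (r n) D)) atTop (𝓝 (∫ γ, f γ ∂(P₁ D))) :=
    ⟨fun n => (φ n : ℝ) + 1, fun n => by positivity,
      tendsto_atTop_add_const_right _ _ (tendsto_natCast_atTop_atTop.comp hφ.tendsto_atTop),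
      hconv₁⟩
  -- (B, l = atTop): a zoom-RECURRENT forward limit point Pω ∈ Ω
  obtain ⟨Pp, hPp, hlimp, hrecp⟩ := hB Ω hN' hZ hC atTop (Or.inl rfl) P hP P₁ hP₁ hlim₁
  -- (2) a backward (α-) limit point P₂ ∈ Ω, from the sequence `Z_{1/(n+1)} P` by (iii)
  obtain ⟨P₂, hP₂, ψ, hψ, hconv₂⟩ :=
    hC (fun n => P.zoom (1 / ((n : ℝ) + 1))) fun n => hmem P hP _ (by positivity)
  have hlim₂ : ∃ s : ℕ → ℝ, (∀ n, 0 < s n) ∧ Tendsto s atTop (𝓝 0) ∧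
      ∀ (D : DobrushinDomain) (f : BoundedContinuousFunction (CurveClass ℂ) ℝ),
        Tendsto (fun n => ∫ γ, f γ ∂(P.zoom (s n) D)) atTop (𝓝 (∫ γ, f γ ∂(P₂ D))) :=
    ⟨fun n => 1 / ((ψ n : ℝ) + 1), fun n => by positivity,
      tendsto_one_div_add_atTop_nhds_zero_nat.comp hψ.tendsto_atTop, hconv₂⟩
  -- (B, l = 𝓝 0): a zoom-RECURRENT backward limit point Pα ∈ Ω
  obtain ⟨Pm, hPm, hlimm, hrecm⟩ := hB Ω hN' hZ hC (𝓝 0) (Or.inr rfl) P hP P₂ hP₂ hlim₂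
  -- (R): recurrent members of Ω are fixed points of the zoom flow
  have hfixp : Pp.IsDilationCovariant := hR Ω hN' hZ hC Pp hPp hrecp
  have hfixm : Pm.IsDilationCovariant := hR Ω hN' hZ hC Pm hPm hrecm
  -- (W): no connecting orbit — P itself is fixed
  have hfix : P.IsDilationCovariant :=
    hW Ω hN' hZ hC P hP ⟨Pp, hPp, hfixp, hlimp⟩ ⟨Pm, hPm, hfixm, hlimm⟩
  -- fixed point of the zoom flow = the crux's dilation clause (proof of `(r:ℂ) ≠ 0` irrelevant)
  exact (ChordalFamily.isDilationCovariant_iff P).1 hfix D r hr0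

/-- Wiring check (an `example`, so that `ZoomRigidity_of` stays the only declaration concluding the
crux): the three sorried stubs feed the skeleton theorem as stated — this term becomes the crux proof when
the three `sorry`s above are discharged, and it certifies that each `__Registered` alias is the type of
its stub. -/
example : Summit.CriticalPhenomena.SAWScalingLimit.Theses.SAWZoomRigidity.ZoomRigidity :=
  ZoomRigidity_of stub_recurrentLimitPoint stub_recurrenceRigidity stub_noConnectingOrbit

/-! ## Sanity (documentation): each stub is a CONSEQUENCE of the crux, hence exactly as safe -/

/-- Under the crux every member of such an `Ω` is dilation covariant; in particular (R) and (W) follow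
(their conclusions concern members of `Ω`), and so does (B) (a fixed point is a recurrent limit point of
its own constant orbit). Recorded for (R): -/
theorem recurrenceRigidity_of_zoomRigidity
    (h : Summit.CriticalPhenomena.SAWScalingLimit.Theses.SAWZoomRigidity.ZoomRigidity) :
    __Registered.stub_recurrenceRigidity := by
  intro Ω hN hZ hC P hP _
  have hN' := fun Q (hQ : Q ∈ Ω) => hN Q hQ
  refine (ChordalFamily.isDilationCovariant_iff P).2 fun D r hr => ?_
  exact h Ω (fun Q hQ => by
    obtain ⟨h1, ⟨K, hK, hKr⟩, h3, h4, h5, h6⟩ := hN' Q hQ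
    exact ⟨h1, ⟨K, hK, hKr⟩, h3, h4, h5, h6⟩) hZ hC P hP D r (Complex.ofReal_ne_zero.2 hr.ne') hr

end Summit.CriticalPhenomena.SAWScalingLimit.Cruxes.ZoomRigidity.Birth

end
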